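import Summits.ResolutionOfSingularities.ResolutionOfSingularities.Theorems.MarkedTransferCampaignW46CuspStaircaseSharp
import Summits.ResolutionOfSingularities.ResolutionOfSingularities.Theorems.MarkedTransferCampaignW46FinPermissibleRunCons
import Summits.ResolutionOfSingularities.ResolutionOfSingularities.Theorems.MarkedTransferCampaignW46FiniteExitBoundCentreGeometry
import Summits.ResolutionOfSingularities.ResolutionOfSingularities.Theorems.MarkedTransferCampaignW46ThreefoldsGammaFreeGlobalLadderWitness
import HarnessLib

/-!
# [OURS · L1 W4.6, rungs (iii)/(i-a)′] The cusp staircase climbed OVER THE ORIGIN: every centre lies over one point, every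
# stage stays in the regime — hence `β` of `FinLocalExitBound` is UNBOUNDED at fixed coarse data `(ord, b, dim) = (p, p, 2)`
# (cell res-hironaka, LADDER-RESOLUTION rung L, D-0089; slot W4.6; seat res-D-brk-2 (CONVERT pool, W4.6 desk's terms);
# host route MarkedTransfer, `--kind proof --supports stmt-ResolutionOfSingularities-16155 --as helper`)

HONEST FRAMING. Everything below is OURS: kernel theorems about res-L1-s46-pv-1's résumé-free sequence types
(`FinPermissibleRun`, `FinLocalExitBound`, `regimePlaneIsolated`), res-L1-s46-pv-5's cusp staircase (`Regime.cuspCurve`,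
`Cusp.exists_pointBlowup`, `Cusp.cuspShape_transform_of_le`, …, files I–XV) and res-L1-s46-pv-13's scheme-level state
`(𝔸²_K, E_n = ((y^p + xⁿ)·𝒪, p))` (`CuspPlane.*`). NOTHING here is a statement of H. Hironaka's manuscript (2017-03-23,
[Hironaka2017]) and nothing here asserts that any statement of it holds; the manuscript enters only through the typed row-001
CANDIDATE carriers. No FACT-LIST premise. AI review is weaker than expert review. No `sorry`; axioms standard; def-free.

## Why this file

res-L1-type-o1's RUNG-MAP-W46 §RUNG (i-a)′ records the KERNEL-RELEVANT WARNING «`β` must NOT be a function of the coarse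
local data `(ord_x J, b, dim)` alone — the plane cusp tower has `⌊N/b⌋` origin blow-ups at constant coarse data», and the
(VAC) clause of `…FiniteExitBound.lean` says the same in prose. pv-5's SHARPNESS file (`…CuspStaircaseSharp.lean`, p503990)
proves that a sequence of length `⌊n/p⌋` EXISTS from `(𝔸²_K, E_n)`, but its exported statements record only the length and
the start — not that every centre lies OVER THE ORIGIN nor that every stage stays in the regime, which is what the clause of
`FinLocalExitBound` needs. This file re-climbs the staircase keeping that bookkeeping (via the `nil`/`cons` API of
`…FinPermissibleRunCons.lean`) and draws the consequence for `β`.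

## What is proved (every prime `p`, every PERFECT field `K` of characteristic `p`)

* `Cusp.exists_successor_over` — one step: pv-5's `exists_pointBlowup` at a closed cusp point `ξ` of exponents `(b, d)`,
  `b < d`, WITH the bookkeeping: the transform is a staircase state again (`Cusp.transform_cuspCurve`), `dim` is preserved,
  and for `2b < d` the new cusp point `ξ′` (exponents `(b, d − b)`, closed) lies OVER `ξ`: `π ξ′ = ξ`.
* `Cusp.exists_finPermissibleRun_over` — for every `L` with `L·b < d`: a finite §2.1-permissible sequence of length `L`
  from `(A, E)` ALL of whose stages `k ≤ L` are staircase states of the same dimension and ALL of whose centres `D_m`,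
  `m < L`, meet the fibre of `Z_m → Z_0` over `ξ` (induction on `L`; the run is `r′.cons …` of the run from the successor).
* `CuspPlane.exists_finPermissibleRun_over_origin` — from K4.6's state `(𝔸²_K, E_n)`, `p < n`, `p ∤ n`: length `n/p`, every
  stage in `Regime.cuspCurve` AND in `regimePlaneIsolated`, every centre over the origin.
* **`CuspPlane.le_beta_of_finLocalExitBound_clause`** — EVERY `β` satisfying the clause of
  `FinLocalExitBound regimePlaneIsolated` has `n/p ≤ β(𝔸²_K, E_n, ξ)` (res-type-008's `one_le_of_finLocalExitBound_clause`,
  p503572, is the case `n = p + 1`); `…_clause_cuspCurve` — the same for the clause on `Regime.cuspCurve`, so pv-5's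
  `β = Σ(E)/b` (`finLocalExitBound_cuspCurve`) is OPTIMAL on the family.
* **`CuspPlane.beta_unbounded_at_coarse_data`** — for every such `β` and every `M` there is an ideal exponent `E` on `𝔸²_K`
  with `E.b = p`, `ord_ξ E.J = p`, `Sing(E) = {ξ}`, `dim 𝔸²_K ≤ 2` and `M ≤ β(𝔸²_K, E, ξ)`: **`β` is unbounded on states with
  the same coarse data** — the WARNING as a kernel theorem.

## References

* res-L1-type-o1, `L/res-L1-type-o1/RUNG-MAP-W46.md` §RUNG (i-a)′ (WARNING); res-L1-s46-pv-1 `…FiniteExitBound.lean`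
  (VAC); res-L1-s46-pv-5 files XI–XV; res-L1-s46-pv-13 `…MohWindowCurveInstance.lean`; res-type-008
  `…FiniteExitBoundWitness.lean`; res-D-pv-046 `…FiniteExitBoundCentreGeometry.lean` (dimension along a point blow-up);
  res-D-pv-036 `…GammaFreeGlobalLadderWitness.lean` (`dim 𝔸²_K ≤ 2`).
* O. Zariski, P. Samuel, *Commutative Algebra* II (1960), Appendix 5 (infinitely near points) — context only. [ZariskiSamuel1960]
* H. Hironaka, ms. 2017-03-23, §2.1 p.4 l.35–39, Th. 16.13 p.87 l.26–28 — scope only, under adjudication. [Hironaka2017]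
-/

noncomputable section

set_option linter.dupNamespace false -- mandated namespace of this single-conjunct summit

open CategoryTheory AlgebraicGeometry TopologicalSpace IsLocalRing

namespace Summit.ResolutionOfSingularities.ResolutionOfSingularities.Theorems

namespace CampaignW46

open Literature.AlgebraicGeometry.Resolution
open Literature.AlgebraicGeometry.Hironaka2017.S02Preliminaries
open Literature.AlgebraicGeometry.Hironaka2017.Datum
open Scheme.IdealSheafData

universe u

namespace Cusp

section Over

variable {p : ℕ} [Fact p.Prime] {K : Type u} [Field K] [CharP K p] [PerfectField K]

/-- **One step of the staircase, with the bookkeeping «over ξ» and «in the regime».** Over a perfect field, at a STAIRCASE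
state `(A, E)` with a closed cusp point `ξ` of exponents `(b, d)`, `b = E.b`, `b < d`: the blow-up of `{ξ}` exists as an
ambient datum `A′` (pv-5 `exists_pointBlowup`), `{ξ}` is §2.1-permissible, the transform is standard AND again a staircase
state (`Cusp.transform_cuspCurve`), `dim A′.Z = dim A.Z`, and if `2b < d` there is a CLOSED cusp point `ξ′` of exponents
`(b, d − b)` for the transform with `π ξ′ = ξ`. [folklore] -/
theorem exists_successor_over (A : AmbientDatum p K) (E : IdealExponent A.Z) (hE : E.IsStandard)
    (hRg : Regime.cuspCurve (p := p) (K := K) A E) {ξ : A.Z} (hξcl : IsClosed ({ξ} : Set A.Z)) {d : ℕ} (hbd : E.b < d)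
    (hshape : CuspShape E.b d (A.Z.presheaf.stalk ξ) (stalkIdeal E.J ξ)) :
    ∃ (A' : AmbientDatum p K) (π : A'.Z ⟶ A.Z) (ξ' : A'.Z), A'.hom = π ≫ A.hom ∧
      IsBlowup π (vanishingIdeal (⟨{ξ}, hξcl⟩ : Closeds A.Z)) ∧ E.IsPermissibleCentre A.hom ⟨{ξ}, hξcl⟩ ∧
      (E.transform π ⟨{ξ}, hξcl⟩).IsStandard ∧ Regime.cuspCurve (p := p) (K := K) A' (E.transform π ⟨{ξ}, hξcl⟩) ∧
      topologicalKrullDim A'.Z = topologicalKrullDim A.Z ∧ IsClosed ({ξ'} : Set A'.Z) ∧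
      (2 * E.b < d → π ξ' = ξ ∧ CuspShape E.b (d - E.b) (A'.Z.presheaf.stalk ξ')
        (stalkIdeal (E.transform π ⟨{ξ}, hξcl⟩).J ξ')) := by
  classical
  have hξS : ξ ∈ E.sing := mem_sing_of_cuspShape hshape hbd.le
  obtain ⟨A', π, hhom, hπ, hperm, hstd⟩ :=
    exists_pointBlowup A E hE hξcl hξS (singleton_ne_univ_of_cuspShape A hshape)
  haveI := A.smooth
  haveI := A'.smooth
  haveI : IsLocallyNoetherian A'.Z := ambient_isLocallyNoetherian A'
  haveI : JacobsonSpace A'.Z := ambient_jacobsonSpace A'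
  haveI : JacobsonSpace A.Z := ambient_jacobsonSpace A
  haveI : LocallyOfFiniteType π := by
    have h : LocallyOfFiniteType (π ≫ A.hom) := by
      rw [← hhom]
      infer_instance
    exact locallyOfFiniteType_of_comp π A.hom
  have hRg' : Regime.cuspCurve (p := p) (K := K) A' (E.transform π ⟨{ξ}, hξcl⟩) :=
    transform_cuspCurve hπ hhom hRg isIrreducible_singleton (Set.singleton_subset_iff.2 hξS)
  -- dimension: `𝔪_ξ ≠ 0` since the stalk has embedding dimension `2`
  have hne : maximalIdeal (A.Z.presheaf.stalk ξ) ≠ ⊥ := by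
    obtain ⟨-, hdim, -⟩ := hshape
    intro h
    rw [h, Submodule.spanFinrank_bot] at hdim
    exact absurd hdim (by decide)
  have hdim : topologicalKrullDim A'.Z = topologicalKrullDim A.Z :=
    topologicalKrullDim_eq_of_blowup_closedPoint A A' hξcl hne hπ
  have hY : stalkIdeal (vanishingIdeal (⟨{ξ}, hξcl⟩ : Closeds A.Z)) ξ = maximalIdeal (A.Z.presheaf.stalk ξ) :=
    stalkIdeal_vanishingIdeal_singleton hξcl
  by_cases h2 : 2 * E.b < d
  · obtain ⟨hreg, hdim2, x, y, hxy, u, hu, hJ⟩ := hshape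
    haveI := hreg
    obtain ⟨c, hc_def⟩ : ∃ c : Fin 2 → A.Z.presheaf.stalk ξ, c = ![x, y] := ⟨_, rfl⟩
    have hc0 : c 0 = x := by rw [hc_def]; rfl
    have hc1 : c 1 = y := by rw [hc_def]; rfl
    have hc : Ideal.span (Set.range c) = maximalIdeal _ := by rw [hc_def, MohWindow.range_vec2]; exact hxy
    have hJc : stalkIdeal E.J ξ = Ideal.span {c 1 ^ E.b + u * c 0 ^ d} := by rw [hJ, hc0, hc1]
    obtain ⟨x', hπx, hle⟩ := MohWindow.exists_le_idealOrder_controlledTransform_of_le hπ hE.2 h2.le hdim2 c hc hY hJc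
    have hshape0 : CuspShape E.b d (A.Z.presheaf.stalk (π x')) (stalkIdeal E.J (π x')) := by
      rw [hπx]; exact ⟨hreg, hdim2, x, y, hxy, u, hu, hJ⟩
    have hY' : stalkIdeal (vanishingIdeal (⟨{ξ}, hξcl⟩ : Closeds A.Z)) (π x') =
        maximalIdeal (A.Z.presheaf.stalk (π x')) := by rw [hπx]; exact hY
    have hcl' : IsClosed ({π.base x'} : Set A.Z) := by
      have : π.base x' = ξ := hπx
      rw [this]; exact hξcl
    refine ⟨A', π, x', hhom, hπ, hperm, hstd, hRg', hdim,
      Cusp.isClosed_singleton_of_le hπ hE.2 hbd hcl' hY' hshape0 hle, fun _ => ⟨hπx, ?_⟩⟩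
    exact Cusp.cuspShape_transform_of_le hπ hE.2 hbd hY' hshape0 hle
  · haveI := A'.irreducible
    obtain ⟨x', -, hx'⟩ := nonempty_inter_closedPoints (Set.univ_nonempty (α := A'.Z))
      isClosed_univ.isLocallyClosed
    exact ⟨A', π, x', hhom, hπ, hperm, hstd, hRg', hdim, hx', fun h => absurd h h2⟩

/-- **THE STAIRCASE CLIMBED OVER `ξ`.** Over a perfect field, from a staircase state `(A, E)` with a closed cusp point `ξ` of
exponents `(b, d)` (`b = E.b`) and every `L` with `L·b < d`: a finite §2.1-permissible sequence `r` of length `L` with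
`(r.A 0, r.E 0) = (A, E)`, EVERY stage `k ≤ L` a staircase state with `dim (r.A k).Z = dim A.Z`, and EVERY centre
`r.D m` (`m < L`) meeting the fibre of `Z_m → Z_0` over `ξ`. Induction on `L`: the run is `FinPermissibleRun.cons` of the
run from the successor point of `exists_successor_over`. [folklore] -/
theorem exists_finPermissibleRun_over (L : ℕ) :
    ∀ (A : AmbientDatum p K) (E : IdealExponent A.Z), E.IsStandard → Regime.cuspCurve (p := p) (K := K) A E →
      ∀ {ξ : A.Z}, IsClosed ({ξ} : Set A.Z) → ∀ {d : ℕ},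
        (E.b < d → CuspShape E.b d (A.Z.presheaf.stalk ξ) (stalkIdeal E.J ξ)) → L * E.b < d →
        ∃ r : FinPermissibleRun p K, r.len = L ∧
          (⟨r.A 0, r.E 0⟩ : Σ A : AmbientDatum p K, IdealExponent A.Z) = ⟨A, E⟩ ∧
          (∀ k, k ≤ r.len → Regime.cuspCurve (p := p) (K := K) (r.A k) (r.E k) ∧
            topologicalKrullDim (r.A k).Z = topologicalKrullDim A.Z) ∧
          ∃ x : (r.A 0).Z, (⟨r.A 0, x⟩ : Σ A : AmbientDatum p K, (A.Z : Type u)) = ⟨A, ξ⟩ ∧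
            ∀ m, m < r.len → ∃ y ∈ (r.D m : Set (r.A m).Z), r.down m y = x := by
  induction L with
  | zero =>
    intro A E hE hRg ξ hξcl d hshape hL
    exact ⟨FinPermissibleRun.nil A E hE, rfl, rfl, fun k hk => ⟨by
      obtain rfl : k = 0 := Nat.le_zero.mp hk; exact hRg, rfl⟩, ξ, rfl, fun m hm => absurd hm (Nat.not_lt_zero m)⟩
  | succ L ih =>
    intro A E hE hRg ξ hξcl d hshape hL
    have hbpos : 0 < E.b := hE.2
    have hbd : E.b < d := by
      have : E.b ≤ (L + 1) * E.b := Nat.le_mul_of_pos_left _ (Nat.succ_pos L)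
      omega
    obtain ⟨A', π, ξ', hhom, hπ, hperm, hstd, hRg', hdim, hξ'cl, hnext⟩ :=
      exists_successor_over A E hE hRg hξcl hbd (hshape hbd)
    -- the transformed state carries the exponent `d - b`
    have hb' : (E.transform π ⟨{ξ}, hξcl⟩).b = E.b := rfl
    have hshape' : (E.transform π ⟨{ξ}, hξcl⟩).b < d - E.b →
        CuspShape (E.transform π ⟨{ξ}, hξcl⟩).b (d - E.b) (A'.Z.presheaf.stalk ξ')
          (stalkIdeal (E.transform π ⟨{ξ}, hξcl⟩).J ξ') := fun hlt => by
      have h2 : 2 * E.b < d := by rw [hb'] at hlt; omega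
      exact (hnext h2).2
    have hL' : L * (E.transform π ⟨{ξ}, hξcl⟩).b < d - E.b := by
      rw [hb']
      rw [Nat.succ_mul] at hL
      omega
    obtain ⟨r', hlen', hstart', hreg', x', hx', hover'⟩ := ih A' _ hstd hRg' hξ'cl hshape' hL'
    -- pin the first stage of `r'` to `A'`
    obtain ⟨hA', hE'⟩ := Sigma.mk.inj_iff.mp hstart'
    obtain ⟨hA'', hx''⟩ := Sigma.mk.inj_iff.mp hx'
    subst hA'
    have hsucc : r'.E 0 = E.transform π ⟨{ξ}, hξcl⟩ := eq_of_heq hE'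
    have hxξ : x' = ξ' := eq_of_heq hx''
    refine ⟨r'.cons A E ⟨{ξ}, hξcl⟩ π hE hperm hhom hπ hsucc, by rw [FinPermissibleRun.cons_len, hlen'], rfl, ?_,
      ξ, rfl, ?_⟩
    · -- regimes and dimensions along the cons
      refine FinPermissibleRun.cons_regime r' A E ⟨{ξ}, hξcl⟩ π hE hperm hhom hπ hsucc
        (Rg := fun A'' E'' => Regime.cuspCurve (p := p) (K := K) A'' E'' ∧
          topologicalKrullDim A''.Z = topologicalKrullDim A.Z) ⟨hRg, rfl⟩ fun k hk => ?_
      obtain ⟨h1, h2⟩ := hreg' k hk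
      exact ⟨h1, h2.trans hdim⟩
    · -- every centre lies over `ξ`
      by_cases h2 : 2 * E.b < d
      · have hπx : π x' = ξ := by rw [hxξ]; exact (hnext h2).1
        exact FinPermissibleRun.cons_over r' A E ⟨{ξ}, hξcl⟩ π hE hperm hhom hπ hsucc (Set.mem_singleton ξ) hπx hover'
      · -- then `L = 0`: only the first centre
        have hL0 : L = 0 := by
          by_contra hL0
          have : 1 ≤ L := Nat.one_le_iff_ne_zero.mpr hL0
          have : E.b ≤ L * E.b := Nat.le_mul_of_pos_left _ this
          rw [Nat.succ_mul] at hL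
          omega
        intro m hm
        rw [FinPermissibleRun.cons_len, hlen', hL0] at hm
        obtain rfl : m = 0 := by omega
        exact ⟨ξ, Set.mem_singleton ξ, rfl⟩

end Over

end Cusp

/-! ## K4.6's family: the climb over the origin and the price of `β` -/

namespace CuspPlane

open MvPolynomial
open Literature.AlgebraicGeometry.Hironaka2017.SpecOrders
open Literature.AlgebraicGeometry.Hironaka2017.S16Proof

variable (p : ℕ) [Fact p.Prime] (K : Type u) [Field K] [CharP K p] [PerfectField K]

/-- [OURS · L1 W4.6; NOT a statement of the manuscript] **The staircase from K4.6's state climbed OVER THE ORIGIN**: for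
`p < n`, `p ∤ n` there is a finite §2.1-permissible sequence of length `n/p` from `(𝔸²_K, E_n)` with EVERY stage in
`Regime.cuspCurve` AND in `regimePlaneIsolated` (dimension `2` is preserved along the point blow-ups) and EVERY centre lying
over the origin `ξ`. [folklore] -/
theorem exists_finPermissibleRun_over_origin {n : ℕ} (hpn : p < n) (hn : ¬ p ∣ n) :
    ∃ r : FinPermissibleRun p K, r.len = n / p ∧
      (⟨r.A 0, r.E 0⟩ : Σ A : AmbientDatum p K, IdealExponent A.Z) =
        ⟨U82Gap.amb p K, ⟨shf (MvPolynomial (Fin 2) K) (Ideal.span {X 1 ^ p + X 0 ^ n}), p⟩⟩ ∧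
      (∀ k, k ≤ r.len → Regime.cuspCurve (p := p) (K := K) (r.A k) (r.E k) ∧
        regimePlaneIsolated (p := p) (K := K) (r.A k) (r.E k)) ∧
      ∃ x : (r.A 0).Z, (⟨r.A 0, x⟩ : Σ A : AmbientDatum p K, (A.Z : Type u)) = ⟨U82Gap.amb p K, U82Gap.ξ K⟩ ∧
        ∀ m, m < r.len → ∃ y ∈ (r.D m : Set (r.A m).Z), r.down m y = x := by
  have hL : n / p * p < n := by
    rcases (Nat.div_mul_le_self n p).lt_or_eq with h | h
    · exact h
    · exact absurd (Dvd.intro_left _ h) hn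
  have hstd := isStandard p K (Nat.lt_of_le_of_lt (Nat.zero_le p) hpn)
  obtain ⟨r, hlen, hstart, hreg, x, hx, hover⟩ := Cusp.exists_finPermissibleRun_over (n / p) (U82Gap.amb p K)
    ⟨shf (MvPolynomial (Fin 2) K) (Ideal.span {X 1 ^ p + X 0 ^ n}), p⟩ hstd (regime_cuspCurve p K hpn hn)
    (U82Gap.ξ_mem_closedPoints K) (fun _ => cuspShape_ξ p K n) hL
  refine ⟨r, hlen, hstart, fun k hk => ?_, x, hx, hover⟩
  obtain ⟨hRg, hdim⟩ := hreg k hk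
  refine ⟨hRg, ?_, hRg.2.1, hRg.2.2.1⟩
  show topologicalKrullDim (r.A k).Z ≤ ((2 : ℕ) : WithBot ℕ∞)
  rw [hdim]
  exact LadderWitness.topologicalKrullDim_Z_le_two K

omit [PerfectField K] in
/-- Transport of a `β`-inequality along an equality of pointed states. [folklore] -/
private theorem le_beta_transport (β : ∀ A : AmbientDatum p K, IdealExponent A.Z → A.Z → ℕ) {N : ℕ}
    (s t : Σ A : AmbientDatum p K, IdealExponent A.Z) (hst : s = t) (x : s.1.Z) (y : t.1.Z)
    (hxy : (⟨s.1, x⟩ : Σ A : AmbientDatum p K, (A.Z : Type u)) = ⟨t.1, y⟩) (h : N ≤ β s.1 s.2 x) : N ≤ β t.1 t.2 y := by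
  subst hst
  obtain ⟨-, hxy'⟩ := Sigma.mk.inj_iff.mp hxy
  rw [← eq_of_heq hxy']
  exact h

/-- [OURS · L1 W4.6 rung (i-a)′; NOT a statement of the manuscript] **THE PRICE OF `β` ON THE CUSP STAIRCASE**: every
function `β(A, E, x)` satisfying the clause of `CampaignW46.FinLocalExitBound regimePlaneIsolated` has
`n/p ≤ β(𝔸²_K, ((y^p + xⁿ)·𝒪, p), ξ)` for `p < n`, `p ∤ n` (take the run of `exists_finPermissibleRun_over_origin` and
`s = {0, …, n/p − 1}`). res-type-008's `one_le_of_finLocalExitBound_clause` is the case `n = p + 1`. [folklore] -/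
theorem le_beta_of_finLocalExitBound_clause {n : ℕ} (hpn : p < n) (hn : ¬ p ∣ n)
    (β : ∀ A : AmbientDatum p K, IdealExponent A.Z → A.Z → ℕ)
    (hβ : ∀ r : FinPermissibleRun p K, (∀ k, k ≤ r.len → regimePlaneIsolated (r.A k) (r.E k)) →
      ∀ (x : (r.A 0).Z) (s : Finset ℕ),
        (∀ m ∈ s, m < r.len ∧ ∃ y ∈ (r.D m : Set (r.A m).Z), r.down m y = x) → s.card ≤ β (r.A 0) (r.E 0) x) :
    n / p ≤ β (U82Gap.amb p K) ⟨shf (MvPolynomial (Fin 2) K) (Ideal.span {X 1 ^ p + X 0 ^ n}), p⟩ (U82Gap.ξ K) := by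
  obtain ⟨r, hlen, hstart, hreg, x, hx, hover⟩ := exists_finPermissibleRun_over_origin p K hpn hn
  have key := hβ r (fun k hk => (hreg k hk).2) x (Finset.range (n / p)) fun m hm => by
    have hm' : m < r.len := by rw [hlen]; exact Finset.mem_range.mp hm
    exact ⟨hm', hover m hm'⟩
  rw [Finset.card_range] at key
  exact le_beta_transport p K β _ _ hstart x (U82Gap.ξ K) hx key

/-- [OURS · L1 W4.6 rung (iii); NOT a statement of the manuscript] The same price for the clause on `Regime.cuspCurve`:
`n/p ≤ β(𝔸²_K, E_n, ξ)` — so pv-5's witness `β = Σ(E)/b` of `finLocalExitBound_cuspCurve` (p502134) is OPTIMAL on K4.6's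
family (`Σ(E_n) = n`, res-D-pv-029 `CuspPlane.cuspIndexAt_ξ`). [folklore] -/
theorem le_beta_of_finLocalExitBound_clause_cuspCurve {n : ℕ} (hpn : p < n) (hn : ¬ p ∣ n)
    (β : ∀ A : AmbientDatum p K, IdealExponent A.Z → A.Z → ℕ)
    (hβ : ∀ r : FinPermissibleRun p K, (∀ k, k ≤ r.len → Regime.cuspCurve (p := p) (K := K) (r.A k) (r.E k)) →
      ∀ (x : (r.A 0).Z) (s : Finset ℕ),
        (∀ m ∈ s, m < r.len ∧ ∃ y ∈ (r.D m : Set (r.A m).Z), r.down m y = x) → s.card ≤ β (r.A 0) (r.E 0) x) :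
    n / p ≤ β (U82Gap.amb p K) ⟨shf (MvPolynomial (Fin 2) K) (Ideal.span {X 1 ^ p + X 0 ^ n}), p⟩ (U82Gap.ξ K) := by
  obtain ⟨r, hlen, hstart, hreg, x, hx, hover⟩ := exists_finPermissibleRun_over_origin p K hpn hn
  have key := hβ r (fun k hk => (hreg k hk).1) x (Finset.range (n / p)) fun m hm => by
    have hm' : m < r.len := by rw [hlen]; exact Finset.mem_range.mp hm
    exact ⟨hm', hover m hm'⟩
  rw [Finset.card_range] at key
  exact le_beta_transport p K β _ _ hstart x (U82Gap.ξ K) hx key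

/-- [OURS · L1 W4.6 rung (i-a)′; NOT a statement of the manuscript] **`β` IS UNBOUNDED AT FIXED COARSE DATA** — the
RUNG-MAP-W46 WARNING / (VAC) sentence as a kernel theorem: for every `β` satisfying the clause of
`FinLocalExitBound regimePlaneIsolated` and every `M` there is an ideal exponent `E` on `𝔸²_K` with the SAME coarse data as
all the others — exponent `E.b = p`, order `ord_ξ E.J = p` at the origin, `Sing(E) = {ξ}`, ambient dimension `≤ 2` — and
`M ≤ β(𝔸²_K, E, ξ)` (namely `E = E_n`, `n = (M + 1)·p + 1`). So `β` cannot be a function of `(ord_x J, b, dim)` alone.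
[folklore] -/
theorem beta_unbounded_at_coarse_data (β : ∀ A : AmbientDatum p K, IdealExponent A.Z → A.Z → ℕ)
    (hβ : ∀ r : FinPermissibleRun p K, (∀ k, k ≤ r.len → regimePlaneIsolated (r.A k) (r.E k)) →
      ∀ (x : (r.A 0).Z) (s : Finset ℕ),
        (∀ m ∈ s, m < r.len ∧ ∃ y ∈ (r.D m : Set (r.A m).Z), r.down m y = x) → s.card ≤ β (r.A 0) (r.E 0) x)
    (M : ℕ) :
    ∃ E : IdealExponent (U82Gap.amb p K).Z, E.b = p ∧ idealOrder E.J (U82Gap.ξ K) = p ∧ E.sing = {U82Gap.ξ K} ∧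
      topologicalKrullDim (U82Gap.amb p K).Z ≤ ((2 : ℕ) : WithBot ℕ∞) ∧ M ≤ β (U82Gap.amb p K) E (U82Gap.ξ K) := by
  have hp1 : 1 < p := (Fact.out : p.Prime).one_lt
  set n := (M + 1) * p + 1 with hn_def
  have hpn : p < n := by
    have : p ≤ (M + 1) * p := Nat.le_mul_of_pos_left _ (Nat.succ_pos M)
    omega
  have hn : ¬ p ∣ n := by
    rintro ⟨c, hc⟩
    have h1 : p ∣ 1 := by
      refine ⟨c - (M + 1), ?_⟩
      rw [Nat.mul_sub, ← hc, hn_def, Nat.mul_comm]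
      omega
    exact absurd (Nat.le_of_dvd one_pos h1) (not_le.mpr hp1)
  have hdiv : M ≤ n / p := by
    refine (Nat.le_div_iff_mul_le (Nat.lt_trans Nat.zero_lt_one hp1)).mpr ?_
    rw [hn_def, Nat.succ_mul]
    omega
  refine ⟨⟨shf (MvPolynomial (Fin 2) K) (Ideal.span {X 1 ^ p + X 0 ^ n}), p⟩, rfl, ?_, sing_eq p K hpn.le hn,
    LadderWitness.topologicalKrullDim_Z_le_two K, hdiv.trans (le_beta_of_finLocalExitBound_clause p K hpn hn β hβ)⟩
  have h := idealOrder_ξ p K (n := n) hpn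
  exact h

end CuspPlane

end CampaignW46

end Summit.ResolutionOfSingularities.ResolutionOfSingularities.Theorems

end
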